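import Summits.RiemannHypothesis.RiemannHypothesis.Theorems.LiDirichletSplit
import Summits.RiemannHypothesis.RiemannHypothesis.Theorems.LiDirichletTrendMainTerm
import HarnessLib

/-!
# PART F⁗ (cell rh-li, engine seat rh-li-eng-5 gen 4) — the ARITHMETIC PART of the Dirichlet Li coefficient against
# route No.12's main term (RH-FREE, GRH-FREE bookkeeping)

With T-D2s (`liDirichletSplit_holds`: `liCoeffCharRe χ n = charLiTrend χ n + charLiOsc χ n`) and the trend/main-term
bookkeeping of `LiDirichletTrendMainTerm.lean` (`|charLiTrend χ n − charLiMainTerm q n| ≤ 3/2`), the quantity route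
No.12 `LiDirichletAsymptotic` bounds — `liCoeffCharRe χ n − charLiMainTerm q n` — IS the arithmetic part `lt_χ(n) = charLiOsc χ n`
of the certified tables (HOME/data/li_dirichlet_lambda_*.tsv, column `Re_lt_arith`) up to `3/2`, uniformly in `q`, `χ`, `n`:

* `abs_liCoeffCharRe_sub_charLiMainTerm_sub_charLiOsc_le` — `|liCoeffCharRe χ n − charLiMainTerm q n − charLiOsc χ n| ≤ 3/2`;
* `abs_charLiOsc_le_of_abs_sub_charLiMainTerm_le` — any bound `|liCoeffCharRe χ n − charLiMainTerm q n| ≤ B` (e.g. the leaf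
  `LiDirichletAsymptoticLaw`'s `C√n log(qn)` on the verified range) transfers to `|charLiOsc χ n| ≤ B + 3/2`, and conversely
  (`abs_sub_charLiMainTerm_le_of_abs_charLiOsc_le`).

So the PROOF-OF-DATA content of the Dirichlet Li asymptotic law is a statement about the oscillating ARITHMETIC column alone — the
object LADDER-RH L-C names («an n-uniform lower bound mechanism for λ_n from the ARITHMETIC side»).  **Nothing in this file bears
on the truth of RH or GRH**; the ∀n sign of `liCoeffCharRe` (⇔ GRH(χ)) is untouched.  bears_on: LADDER-RH L-D (COLUMN 4 LI,
Dirichlet rows) ↔ L-P(P1⁺χ).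
-/

noncomputable section

-- D-0017: `Summit.<S>.<S>.…` is the designed namespace of a single-problem summit.
set_option linter.dupNamespace false

namespace Summit.RiemannHypothesis.RiemannHypothesis.Theorems.LiTheory

open Literature.NumberTheory.LFunctions Literature.NumberTheory.LFunctions.LiDirichlet

variable {q : ℕ} [NeZero q] {χ : DirichletCharacter ℂ q}

/-- **RH-FREE. The criterion object minus No.12's main term is the arithmetic part, up to `3/2`.**  For a primitive
character `χ` mod `q > 1` and `n ≥ 1`:

  `| liCoeffCharRe χ n − charLiMainTerm q n − charLiOsc χ n | ≤ 3/2`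

(`liCoeffCharRe = charLiTrend + charLiOsc` by T-D2s, and `|charLiTrend − charLiMainTerm| ≤ 3/2`).
[cite: Li2004, Thm 2; Lagarias2007LiCoefficients, (1.13)–(1.15)] -/
theorem abs_liCoeffCharRe_sub_charLiMainTerm_sub_charLiOsc_le (hχ : χ.IsPrimitive) (hq : 1 < q) {n : ℕ} (hn : 1 ≤ n) :
    |liCoeffCharRe χ n - charLiMainTerm q n - charLiOsc χ n| ≤ 3 / 2 := by
  have hsplit := liDirichletSplit_holds q χ hχ hq n hn
  have htrend := abs_charLiTrend_sub_charLiMainTerm_le χ hn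
  have e : liCoeffCharRe χ n - charLiMainTerm q n - charLiOsc χ n = charLiTrend χ n - charLiMainTerm q n := by
    rw [hsplit]; ring
  rw [e]
  exact htrend

/-- **Transfer to the arithmetic part.**  If `|liCoeffCharRe χ n − charLiMainTerm q n| ≤ B` (primitive `χ` mod `q > 1`, `n ≥ 1`)
then `|charLiOsc χ n| ≤ B + 3/2` — e.g. route No.12's leaf gives `|lt_χ(n)| ≤ C√n log(qn) + 3/2` on its verified range.
[cite: Li2004, Thm 2] -/
theorem abs_charLiOsc_le_of_abs_sub_charLiMainTerm_le (hχ : χ.IsPrimitive) (hq : 1 < q) {n : ℕ} (hn : 1 ≤ n) {B : ℝ}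
    (hB : |liCoeffCharRe χ n - charLiMainTerm q n| ≤ B) : |charLiOsc χ n| ≤ B + 3 / 2 := by
  have h := abs_liCoeffCharRe_sub_charLiMainTerm_sub_charLiOsc_le hχ hq hn
  have e : charLiOsc χ n = (liCoeffCharRe χ n - charLiMainTerm q n) -
      (liCoeffCharRe χ n - charLiMainTerm q n - charLiOsc χ n) := by ring
  rw [e]
  exact (abs_sub _ _).trans (add_le_add hB h)

/-- **Transfer from the arithmetic part.**  Conversely, `|charLiOsc χ n| ≤ B` gives `|liCoeffCharRe χ n − charLiMainTerm q n| ≤ B + 3/2`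
(primitive `χ` mod `q > 1`, `n ≥ 1`): a bound on the arithmetic column is a bound on the criterion object around its main term.
[cite: Li2004, Thm 2] -/
theorem abs_sub_charLiMainTerm_le_of_abs_charLiOsc_le (hχ : χ.IsPrimitive) (hq : 1 < q) {n : ℕ} (hn : 1 ≤ n) {B : ℝ}
    (hB : |charLiOsc χ n| ≤ B) : |liCoeffCharRe χ n - charLiMainTerm q n| ≤ B + 3 / 2 := by
  have h := abs_liCoeffCharRe_sub_charLiMainTerm_sub_charLiOsc_le hχ hq hn
  have e : liCoeffCharRe χ n - charLiMainTerm q n =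
      charLiOsc χ n + (liCoeffCharRe χ n - charLiMainTerm q n - charLiOsc χ n) := by ring
  rw [e]
  exact (abs_add_le _ _).trans (add_le_add hB h)

end Summit.RiemannHypothesis.RiemannHypothesis.Theorems.LiTheory

end
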